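import Summits.CriticalPhenomena.PercolationContinuityZ3.Theorems.PercNearOneGluingNoHeavyLowerTailSahiE3ExchangeNested
import Mathlib.Tactic.Linarith
import Mathlib.Tactic.Ring
import Mathlib.Tactic.Positivity
import HarnessLib
import HarnessLib.Audit

/-!
# `NoHeavyLowerTail` (crux stmt-CriticalPhenomena-4575), Sahi programme P4: the 2×2 exchange lemma — one-side-nested classes with corners MEETING the slot

Support file (cell `prim-l12`, seat P4, generation 26; `--supports stmt-CriticalPhenomena-4575`).  No named facts, no sorries;
standard axioms; def-free.

Context (HOME prim-l12-p4/FROM-prim-l12-p4-gen26-*.md; predecessor `…SahiE3ExchangeNested`).  For a Harris block `(B, w, V)`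
(`v = w(V)`, `a(X) = w(X∩V)`, `need(X,Y) = w(X)a(Y) + w(Y)a(X) − v·w(X)w(Y)`), a pair-certificate `R ≥ 0` on `V` and a
configuration of up-sets `O ⊆ K∩L`, `K∪L ⊆ P`, `O' ⊆ K'∩L'`, `K'∪L' ⊆ P'`, `…SahiE3ExchangeNested` proves the exchange
inequality `X_a + R(KK'V) + R(LL'V) − need(K,L') − need(L,K') + (1−v)·Y ≥ 0` (`X_a = a(PP') + a(OO') − w(P)a(O') − w(P')a(O)`,
any bracket `Y ≥` the product of the two annulus masses) from the asymmetric diamond packing when ONE SIDE IS NESTED (`L ⊆ K` or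
`K ⊆ L`) and ONE CORNER MISSES THE SLOT (`O ∩ V = ∅` or `O' ∩ V = ∅`).  This file weakens the corner hypothesis to a TRACE
condition: it suffices that the corner's slot-trace avoids the OPPOSITE ANNULUS,
  `O' ∩ V ∩ (P ∖ O) = ∅`   (resp. `O ∩ V ∩ (P' ∖ O') = ∅`),
at the price of one more Harris hypothesis, `w(P)·a(O') ≤ a(P∩O')` (resp. `w(P')·a(O) ≤ a(O∩P')`), true for up-sets under an
FKG weight.  Proof: under the trace condition `a(P∩O') = a(O∩O')`, so the corner terms `a(OO') − w(P)a(O')` of `X_a`, which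
vanish when `O' ∩ V = ∅`, are instead `≥ 0` by Harris; the rest of the gen-21 decomposition is unchanged.  Numerically (gen 26,
HOME memo: Bool³ and 3×3, ≈ 1.1·10⁷ configuration pairs × both brackets, exact enumeration) the four theorems have no
counterexample, and together with their σ-images (nested PRIMED side) they cover ≈ 90 % of all crossing configuration pairs on
Bool³ / 3×3 (the slot-null-corner versions: ≈ 50 %).  In the pure anti-nested class (`P = K ⊋ L = O`, `P' = L' ⊋ K' = O'`) the
trace condition says exactly that the two supplies are NESTED (`K∩K'∩V ⊆ L∩L'∩V`), where the packing is the same-footprint pair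
`(K,K'), (L,L')`.
-/

namespace Summit.CriticalPhenomena.PercolationContinuityZ3.Theorems.SahiE3ExchangeNestedCorner

open Finset SahiE3DimerPacking SahiE3ExchangeCross SahiE3ExchangeEmptyLayer SahiE3ExchangeNested
open scoped BigOperators

variable {B : Type*} [DecidableEq B]

/-- Trace identity behind the weakened corner condition: if `O ⊆ P` and no point of `O' ∩ V` lies in `P ∖ O`, then
`(P ∩ O') ∩ V = (O ∩ O') ∩ V`. [this work] -/
theorem inter_corner_trace_eq (V P O O' : Finset B) (hOP : O ⊆ P) (hO'V : (O' ∩ (P \ O)) ∩ V = ∅) :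
    (P ∩ O') ∩ V = (O ∩ O') ∩ V := by
  ext b
  simp only [Finset.mem_inter]
  constructor
  · rintro ⟨⟨hbP, hbO'⟩, hbV⟩
    by_cases hbO : b ∈ O
    · exact ⟨⟨hbO, hbO'⟩, hbV⟩
    · exfalso
      have hmem : b ∈ (O' ∩ (P \ O)) ∩ V := by
        simp only [Finset.mem_inter, Finset.mem_sdiff]; exact ⟨⟨hbO', hbP, hbO⟩, hbV⟩
      rw [hO'V] at hmem
      exact Finset.notMem_empty b hmem
  · rintro ⟨⟨hbO, hbO'⟩, hbV⟩
    exact ⟨⟨hOP hbO, hbO'⟩, hbV⟩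

/-- **Nested unprimed side `L ⊆ K`, corner `O` with trace off the primed annulus (`O ∩ V ∩ (P'∖O') = ∅`).**  As
`…SahiE3ExchangeNested.exchange_nestedLK_cornerO` (packing `(K, K'∩L')`, `(L, K'∪L')`, Harris for `(P, P'∩V)`, bracket
`Y ≥ (w(K)−w(L))·(w(L')−w(K'∩L'))`) with `O ∩ V = ∅` weakened to the trace condition plus Harris for `(P', O∩V)`. [this work] -/
theorem exchange_nestedLK_cornerTraceO [Fintype B] (w R : B → ℝ) (hw : ∀ b, 0 ≤ w b) (hw1 : ∑ b, w b = 1)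
    (V K L P O K' L' P' O' : Finset B) (Y : ℝ) (hR : ∀ b ∈ V, 0 ≤ R b)
    (hLK : L ⊆ K) (hKP : K ⊆ P) (hOK' : O' ⊆ K') (hKP' : K' ⊆ P') (hLP' : L' ⊆ P')
    (hOV : (O ∩ (P' \ O')) ∩ V = ∅)
    (hHarP'O : (∑ b ∈ P', w b) * (∑ b ∈ O ∩ V, w b) ≤ ∑ b ∈ (O ∩ P') ∩ V, w b)
    (hpair₁ : (∑ b ∈ K, w b) * (∑ b ∈ (K' ∩ L') ∩ V, w b) + (∑ b ∈ K' ∩ L', w b) * (∑ b ∈ K ∩ V, w b)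
        - (∑ b ∈ V, w b) * (∑ b ∈ K, w b) * (∑ b ∈ K' ∩ L', w b) ≤ ∑ b ∈ (K ∩ (K' ∩ L')) ∩ V, R b)
    (hpair₂ : (∑ b ∈ L, w b) * (∑ b ∈ (K' ∪ L') ∩ V, w b) + (∑ b ∈ K' ∪ L', w b) * (∑ b ∈ L ∩ V, w b)
        - (∑ b ∈ V, w b) * (∑ b ∈ L, w b) * (∑ b ∈ K' ∪ L', w b) ≤ ∑ b ∈ (L ∩ (K' ∪ L')) ∩ V, R b)
    (hHarV : (∑ b ∈ P, w b) * (∑ b ∈ P' ∩ V, w b) ≤ ∑ b ∈ (P ∩ P') ∩ V, w b)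
    (hY : ((∑ b ∈ K, w b) - ∑ b ∈ L, w b) * ((∑ b ∈ L', w b) - ∑ b ∈ K' ∩ L', w b) ≤ Y) :
    0 ≤ (∑ b ∈ (P ∩ P') ∩ V, w b) + (∑ b ∈ (O ∩ O') ∩ V, w b)
        - (∑ b ∈ P, w b) * (∑ b ∈ O' ∩ V, w b) - (∑ b ∈ P', w b) * (∑ b ∈ O ∩ V, w b)
        + (∑ b ∈ (K ∩ K') ∩ V, R b) + (∑ b ∈ (L ∩ L') ∩ V, R b)
        - ((∑ b ∈ K, w b) * (∑ b ∈ L' ∩ V, w b) + (∑ b ∈ L', w b) * (∑ b ∈ K ∩ V, w b)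
            - (∑ b ∈ V, w b) * (∑ b ∈ K, w b) * (∑ b ∈ L', w b))
        - ((∑ b ∈ L, w b) * (∑ b ∈ K' ∩ V, w b) + (∑ b ∈ K', w b) * (∑ b ∈ L ∩ V, w b)
            - (∑ b ∈ V, w b) * (∑ b ∈ L, w b) * (∑ b ∈ K', w b))
        + (1 - ∑ b ∈ V, w b) * Y := by
  have hsup := nestedLK_footprints_le_supply R V K L K' L' hR hLK
  -- the O-sums vanish
  have hP'O := inter_corner_trace_eq V P' O' O (hOK'.trans hKP') hOV
  have hcomm : (O ∩ P') ∩ V = (P' ∩ O) ∩ V := by rw [Finset.inter_comm O P']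
  have hcomm2 : (O' ∩ O) ∩ V = (O ∩ O') ∩ V := by rw [Finset.inter_comm O' O]
  rw [hcomm, hP'O, hcomm2] at hHarP'O
  have hJ : ∑ b ∈ K' ∪ L', w b = ∑ b ∈ K', w b + ∑ b ∈ L', w b - ∑ b ∈ K' ∩ L', w b := by
    have := sum_union_trace w (Finset.univ : Finset B) K' L'
    simpa only [Finset.inter_univ] using this
  have hJV := sum_union_trace w V K' L'
  rw [hJ, hJV] at hpair₂
  -- four-set and trace facts
  have h4V := union_inter_le w V K' L' P' (fun b _ => hw b) hKP' hLP'
  have hOK'V : ∑ b ∈ O' ∩ V, w b ≤ ∑ b ∈ K' ∩ V, w b :=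
    sum_le_sum_of_subset' w hw (Finset.inter_subset_inter hOK' le_rfl)
  have hcD := trace_diff_le w V K L hw hLK
  have hv1 : ∑ b ∈ V, w b ≤ 1 := by
    rw [← hw1]; exact sum_le_sum_of_subset' w hw (Finset.subset_univ V)
  have hl0 : 0 ≤ ∑ b ∈ L, w b := Finset.sum_nonneg fun b _ => hw b
  have hlk : ∑ b ∈ L, w b ≤ ∑ b ∈ K, w b := sum_le_sum_of_subset' w hw hLK
  have hkp : ∑ b ∈ K, w b ≤ ∑ b ∈ P, w b := sum_le_sum_of_subset' w hw hKP
  have hML'w : ∑ b ∈ K' ∩ L', w b ≤ ∑ b ∈ L', w b := sum_le_sum_of_subset' w hw Finset.inter_subset_right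
  have hML'V : ∑ b ∈ (K' ∩ L') ∩ V, w b ≤ ∑ b ∈ L' ∩ V, w b :=
    sum_le_sum_of_subset' w hw (Finset.inter_subset_inter Finset.inter_subset_right le_rfl)
  set p := ∑ b ∈ P, w b
  set k := ∑ b ∈ K, w b
  set l := ∑ b ∈ L, w b
  set v := ∑ b ∈ V, w b
  set aK := ∑ b ∈ K ∩ V, w b
  set aL := ∑ b ∈ L ∩ V, w b
  set p' := ∑ b ∈ P', w b
  set k' := ∑ b ∈ K', w b
  set l' := ∑ b ∈ L', w b
  set m' := ∑ b ∈ K' ∩ L', w b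
  set aP' := ∑ b ∈ P' ∩ V, w b
  set aK' := ∑ b ∈ K' ∩ V, w b
  set aL' := ∑ b ∈ L' ∩ V, w b
  set aO' := ∑ b ∈ O' ∩ V, w b
  set aM' := ∑ b ∈ (K' ∩ L') ∩ V, w b
  have F2 : (k - l) * (aL' - aM') ≤ p * (aP' - aO') := by
    have h1 : aL' - aM' ≤ aP' - aO' := by linarith
    have h2 : 0 ≤ aL' - aM' := by linarith
    have h3 : k - l ≤ p := by linarith
    calc (k - l) * (aL' - aM') ≤ (k - l) * (aP' - aO') := mul_le_mul_of_nonneg_left h1 (by linarith)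
      _ ≤ p * (aP' - aO') := mul_le_mul_of_nonneg_right h3 (by linarith)
  have F3 : 0 ≤ (l' - m') * ((k - l) - (aK - aL)) := mul_nonneg (by linarith) (by linarith)
  have F4 : 0 ≤ (1 - v) * (Y - (k - l) * (l' - m')) := mul_nonneg (by linarith) (by linarith)
  have hp'0 : 0 ≤ ∑ b ∈ P', w b := Finset.sum_nonneg fun b _ => hw b
  nlinarith [hsup, hpair₁, hpair₂, hHarV, F2, F3, F4, hHarP'O]

/-- **Nested unprimed side `L ⊆ K`, corner `O'` with trace off the unprimed annulus (`O' ∩ V ∩ (P∖O) = ∅`).**  As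
`…SahiE3ExchangeNested.exchange_nestedLK_cornerO'` (Harris for `(P', P∩V)`) with `O' ∩ V = ∅` weakened to the trace condition plus
Harris for `(P, O'∩V)`. [this work] -/
theorem exchange_nestedLK_cornerTraceO' [Fintype B] (w R : B → ℝ) (hw : ∀ b, 0 ≤ w b) (hw1 : ∑ b, w b = 1)
    (V K L P O K' L' P' O' : Finset B) (Y : ℝ) (hR : ∀ b ∈ V, 0 ≤ R b)
    (hOL : O ⊆ L) (hLK : L ⊆ K) (hKP : K ⊆ P) (hKP' : K' ⊆ P') (hLP' : L' ⊆ P')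
    (hO'V : (O' ∩ (P \ O)) ∩ V = ∅)
    (hHarPO' : (∑ b ∈ P, w b) * (∑ b ∈ O' ∩ V, w b) ≤ ∑ b ∈ (P ∩ O') ∩ V, w b)
    (hpair₁ : (∑ b ∈ K, w b) * (∑ b ∈ (K' ∩ L') ∩ V, w b) + (∑ b ∈ K' ∩ L', w b) * (∑ b ∈ K ∩ V, w b)
        - (∑ b ∈ V, w b) * (∑ b ∈ K, w b) * (∑ b ∈ K' ∩ L', w b) ≤ ∑ b ∈ (K ∩ (K' ∩ L')) ∩ V, R b)
    (hpair₂ : (∑ b ∈ L, w b) * (∑ b ∈ (K' ∪ L') ∩ V, w b) + (∑ b ∈ K' ∪ L', w b) * (∑ b ∈ L ∩ V, w b)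
        - (∑ b ∈ V, w b) * (∑ b ∈ L, w b) * (∑ b ∈ K' ∪ L', w b) ≤ ∑ b ∈ (L ∩ (K' ∪ L')) ∩ V, R b)
    (hHarV' : (∑ b ∈ P', w b) * (∑ b ∈ P ∩ V, w b) ≤ ∑ b ∈ (P ∩ P') ∩ V, w b)
    (hY : ((∑ b ∈ K, w b) - ∑ b ∈ L, w b) * ((∑ b ∈ L', w b) - ∑ b ∈ K' ∩ L', w b) ≤ Y) :
    0 ≤ (∑ b ∈ (P ∩ P') ∩ V, w b) + (∑ b ∈ (O ∩ O') ∩ V, w b)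
        - (∑ b ∈ P, w b) * (∑ b ∈ O' ∩ V, w b) - (∑ b ∈ P', w b) * (∑ b ∈ O ∩ V, w b)
        + (∑ b ∈ (K ∩ K') ∩ V, R b) + (∑ b ∈ (L ∩ L') ∩ V, R b)
        - ((∑ b ∈ K, w b) * (∑ b ∈ L' ∩ V, w b) + (∑ b ∈ L', w b) * (∑ b ∈ K ∩ V, w b)
            - (∑ b ∈ V, w b) * (∑ b ∈ K, w b) * (∑ b ∈ L', w b))
        - ((∑ b ∈ L, w b) * (∑ b ∈ K' ∩ V, w b) + (∑ b ∈ K', w b) * (∑ b ∈ L ∩ V, w b)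
            - (∑ b ∈ V, w b) * (∑ b ∈ L, w b) * (∑ b ∈ K', w b))
        + (1 - ∑ b ∈ V, w b) * Y := by
  have hsup := nestedLK_footprints_le_supply R V K L K' L' hR hLK
  have hPO' := inter_corner_trace_eq V P O O' (hOL.trans (hLK.trans hKP)) hO'V
  rw [hPO'] at hHarPO'
  have hJ : ∑ b ∈ K' ∪ L', w b = ∑ b ∈ K', w b + ∑ b ∈ L', w b - ∑ b ∈ K' ∩ L', w b := by
    have := sum_union_trace w (Finset.univ : Finset B) K' L'
    simpa only [Finset.inter_univ] using this
  have hJV := sum_union_trace w V K' L'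
  rw [hJ, hJV] at hpair₂
  have h4 : ∑ b ∈ K', w b + ∑ b ∈ L', w b ≤ ∑ b ∈ P', w b + ∑ b ∈ K' ∩ L', w b := by
    have := union_inter_le w (Finset.univ : Finset B) K' L' P' (fun b _ => hw b) hKP' hLP'
    simpa only [Finset.inter_univ] using this
  have hcE' := trace_diff_le w V L' (K' ∩ L') hw Finset.inter_subset_right
  have haPO : ∑ b ∈ K ∩ V, w b - ∑ b ∈ L ∩ V, w b ≤ ∑ b ∈ P ∩ V, w b - ∑ b ∈ O ∩ V, w b := by
    have h1 : ∑ b ∈ K ∩ V, w b ≤ ∑ b ∈ P ∩ V, w b := sum_le_sum_of_subset' w hw (Finset.inter_subset_inter hKP le_rfl)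
    have h2 : ∑ b ∈ O ∩ V, w b ≤ ∑ b ∈ L ∩ V, w b := sum_le_sum_of_subset' w hw (Finset.inter_subset_inter hOL le_rfl)
    linarith
  have haLK : ∑ b ∈ L ∩ V, w b ≤ ∑ b ∈ K ∩ V, w b := sum_le_sum_of_subset' w hw (Finset.inter_subset_inter hLK le_rfl)
  have hv1 : ∑ b ∈ V, w b ≤ 1 := by
    rw [← hw1]; exact sum_le_sum_of_subset' w hw (Finset.subset_univ V)
  have hl0 : 0 ≤ ∑ b ∈ L, w b := Finset.sum_nonneg fun b _ => hw b
  have hlk : ∑ b ∈ L, w b ≤ ∑ b ∈ K, w b := sum_le_sum_of_subset' w hw hLK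
  have hp'0 : 0 ≤ ∑ b ∈ P', w b := Finset.sum_nonneg fun b _ => hw b
  have hk'nn : 0 ≤ ∑ b ∈ K', w b := Finset.sum_nonneg fun b _ => hw b
  have hl'nn : 0 ≤ ∑ b ∈ L', w b := Finset.sum_nonneg fun b _ => hw b
  have hML'w : ∑ b ∈ K' ∩ L', w b ≤ ∑ b ∈ L', w b := sum_le_sum_of_subset' w hw Finset.inter_subset_right
  have hk'0 : 0 ≤ ∑ b ∈ K' ∩ L', w b := Finset.sum_nonneg fun b _ => hw b
  set p := ∑ b ∈ P, w b
  set k := ∑ b ∈ K, w b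
  set l := ∑ b ∈ L, w b
  set v := ∑ b ∈ V, w b
  set aP := ∑ b ∈ P ∩ V, w b
  set aK := ∑ b ∈ K ∩ V, w b
  set aL := ∑ b ∈ L ∩ V, w b
  set aO := ∑ b ∈ O ∩ V, w b
  set p' := ∑ b ∈ P', w b
  set k' := ∑ b ∈ K', w b
  set l' := ∑ b ∈ L', w b
  set m' := ∑ b ∈ K' ∩ L', w b
  set aL' := ∑ b ∈ L' ∩ V, w b
  set aM' := ∑ b ∈ (K' ∩ L') ∩ V, w b
  have F2 : (l' - m') * (aK - aL) ≤ p' * (aP - aO) := by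
    have h1 : aK - aL ≤ aP - aO := haPO
    have h2 : 0 ≤ aK - aL := by linarith
    have h3 : l' - m' ≤ p' := by linarith
    calc (l' - m') * (aK - aL) ≤ (l' - m') * (aP - aO) := mul_le_mul_of_nonneg_left h1 (by linarith)
      _ ≤ p' * (aP - aO) := mul_le_mul_of_nonneg_right h3 (by linarith)
  have F3 : 0 ≤ (k - l) * ((l' - m') - (aL' - aM')) := mul_nonneg (by linarith) (by linarith)
  have F4 : 0 ≤ (1 - v) * (Y - (k - l) * (l' - m')) := mul_nonneg (by linarith) (by linarith)
  have hp0 : 0 ≤ ∑ b ∈ P, w b := Finset.sum_nonneg fun b _ => hw b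
  nlinarith [hsup, hpair₁, hpair₂, hHarV', F2, F3, F4, hHarPO']

/-- **Nested unprimed side `K ⊆ L`, corner `O` with trace off the primed annulus (`O ∩ V ∩ (P'∖O') = ∅`).**  As
`…SahiE3ExchangeNested.exchange_nestedKL_cornerO` (packing `(L, K'∩L')`, `(K, K'∪L')`) with `O ∩ V = ∅` weakened to the trace
condition plus Harris for `(P', O∩V)`. [this work] -/
theorem exchange_nestedKL_cornerTraceO [Fintype B] (w R : B → ℝ) (hw : ∀ b, 0 ≤ w b) (hw1 : ∑ b, w b = 1)
    (V K L P O K' L' P' O' : Finset B) (Y : ℝ) (hR : ∀ b ∈ V, 0 ≤ R b)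
    (hKL : K ⊆ L) (hLP : L ⊆ P) (hOL' : O' ⊆ L') (hKP' : K' ⊆ P') (hLP' : L' ⊆ P')
    (hOV : (O ∩ (P' \ O')) ∩ V = ∅)
    (hHarP'O : (∑ b ∈ P', w b) * (∑ b ∈ O ∩ V, w b) ≤ ∑ b ∈ (O ∩ P') ∩ V, w b)
    (hpair₁ : (∑ b ∈ L, w b) * (∑ b ∈ (K' ∩ L') ∩ V, w b) + (∑ b ∈ K' ∩ L', w b) * (∑ b ∈ L ∩ V, w b)
        - (∑ b ∈ V, w b) * (∑ b ∈ L, w b) * (∑ b ∈ K' ∩ L', w b) ≤ ∑ b ∈ (L ∩ (K' ∩ L')) ∩ V, R b)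
    (hpair₂ : (∑ b ∈ K, w b) * (∑ b ∈ (K' ∪ L') ∩ V, w b) + (∑ b ∈ K' ∪ L', w b) * (∑ b ∈ K ∩ V, w b)
        - (∑ b ∈ V, w b) * (∑ b ∈ K, w b) * (∑ b ∈ K' ∪ L', w b) ≤ ∑ b ∈ (K ∩ (K' ∪ L')) ∩ V, R b)
    (hHarV : (∑ b ∈ P, w b) * (∑ b ∈ P' ∩ V, w b) ≤ ∑ b ∈ (P ∩ P') ∩ V, w b)
    (hY : ((∑ b ∈ L, w b) - ∑ b ∈ K, w b) * ((∑ b ∈ K', w b) - ∑ b ∈ K' ∩ L', w b) ≤ Y) :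
    0 ≤ (∑ b ∈ (P ∩ P') ∩ V, w b) + (∑ b ∈ (O ∩ O') ∩ V, w b)
        - (∑ b ∈ P, w b) * (∑ b ∈ O' ∩ V, w b) - (∑ b ∈ P', w b) * (∑ b ∈ O ∩ V, w b)
        + (∑ b ∈ (K ∩ K') ∩ V, R b) + (∑ b ∈ (L ∩ L') ∩ V, R b)
        - ((∑ b ∈ K, w b) * (∑ b ∈ L' ∩ V, w b) + (∑ b ∈ L', w b) * (∑ b ∈ K ∩ V, w b)
            - (∑ b ∈ V, w b) * (∑ b ∈ K, w b) * (∑ b ∈ L', w b))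
        - ((∑ b ∈ L, w b) * (∑ b ∈ K' ∩ V, w b) + (∑ b ∈ K', w b) * (∑ b ∈ L ∩ V, w b)
            - (∑ b ∈ V, w b) * (∑ b ∈ L, w b) * (∑ b ∈ K', w b))
        + (1 - ∑ b ∈ V, w b) * Y := by
  have hsup := nestedKL_footprints_le_supply R V K L K' L' hR hKL
  have hP'O := inter_corner_trace_eq V P' O' O (hOL'.trans hLP') hOV
  have hcomm : (O ∩ P') ∩ V = (P' ∩ O) ∩ V := by rw [Finset.inter_comm O P']
  have hcomm2 : (O' ∩ O) ∩ V = (O ∩ O') ∩ V := by rw [Finset.inter_comm O' O]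
  rw [hcomm, hP'O, hcomm2] at hHarP'O
  have hJ : ∑ b ∈ K' ∪ L', w b = ∑ b ∈ K', w b + ∑ b ∈ L', w b - ∑ b ∈ K' ∩ L', w b := by
    have := sum_union_trace w (Finset.univ : Finset B) K' L'
    simpa only [Finset.inter_univ] using this
  have hJV := sum_union_trace w V K' L'
  rw [hJ, hJV] at hpair₂
  have h4V := union_inter_le w V K' L' P' (fun b _ => hw b) hKP' hLP'
  have hOL'V : ∑ b ∈ O' ∩ V, w b ≤ ∑ b ∈ L' ∩ V, w b :=
    sum_le_sum_of_subset' w hw (Finset.inter_subset_inter hOL' le_rfl)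
  have hcD := trace_diff_le w V L K hw hKL
  have hv1 : ∑ b ∈ V, w b ≤ 1 := by
    rw [← hw1]; exact sum_le_sum_of_subset' w hw (Finset.subset_univ V)
  have hk0 : 0 ≤ ∑ b ∈ K, w b := Finset.sum_nonneg fun b _ => hw b
  have hkl : ∑ b ∈ K, w b ≤ ∑ b ∈ L, w b := sum_le_sum_of_subset' w hw hKL
  have hlp : ∑ b ∈ L, w b ≤ ∑ b ∈ P, w b := sum_le_sum_of_subset' w hw hLP
  have hMK'w : ∑ b ∈ K' ∩ L', w b ≤ ∑ b ∈ K', w b := sum_le_sum_of_subset' w hw Finset.inter_subset_left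
  have hMK'V : ∑ b ∈ (K' ∩ L') ∩ V, w b ≤ ∑ b ∈ K' ∩ V, w b :=
    sum_le_sum_of_subset' w hw (Finset.inter_subset_inter Finset.inter_subset_left le_rfl)
  set p := ∑ b ∈ P, w b
  set k := ∑ b ∈ K, w b
  set l := ∑ b ∈ L, w b
  set v := ∑ b ∈ V, w b
  set aK := ∑ b ∈ K ∩ V, w b
  set aL := ∑ b ∈ L ∩ V, w b
  set p' := ∑ b ∈ P', w b
  set k' := ∑ b ∈ K', w b
  set l' := ∑ b ∈ L', w b
  set m' := ∑ b ∈ K' ∩ L', w b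
  set aP' := ∑ b ∈ P' ∩ V, w b
  set aK' := ∑ b ∈ K' ∩ V, w b
  set aL' := ∑ b ∈ L' ∩ V, w b
  set aO' := ∑ b ∈ O' ∩ V, w b
  set aM' := ∑ b ∈ (K' ∩ L') ∩ V, w b
  have F2 : (l - k) * (aK' - aM') ≤ p * (aP' - aO') := by
    have h1 : aK' - aM' ≤ aP' - aO' := by linarith
    have h2 : 0 ≤ aK' - aM' := by linarith
    have h3 : l - k ≤ p := by linarith
    calc (l - k) * (aK' - aM') ≤ (l - k) * (aP' - aO') := mul_le_mul_of_nonneg_left h1 (by linarith)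
      _ ≤ p * (aP' - aO') := mul_le_mul_of_nonneg_right h3 (by linarith)
  have F3 : 0 ≤ (k' - m') * ((l - k) - (aL - aK)) := mul_nonneg (by linarith) (by linarith)
  have F4 : 0 ≤ (1 - v) * (Y - (l - k) * (k' - m')) := mul_nonneg (by linarith) (by linarith)
  have hp'0 : 0 ≤ ∑ b ∈ P', w b := Finset.sum_nonneg fun b _ => hw b
  nlinarith [hsup, hpair₁, hpair₂, hHarV, F2, F3, F4, hHarP'O]

/-- **Nested unprimed side `K ⊆ L`, corner `O'` with trace off the unprimed annulus (`O' ∩ V ∩ (P∖O) = ∅`).**  As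
`…SahiE3ExchangeNested.exchange_nestedKL_cornerO'` with `O' ∩ V = ∅` weakened to the trace condition plus Harris for `(P, O'∩V)`.
[this work] -/
theorem exchange_nestedKL_cornerTraceO' [Fintype B] (w R : B → ℝ) (hw : ∀ b, 0 ≤ w b) (hw1 : ∑ b, w b = 1)
    (V K L P O K' L' P' O' : Finset B) (Y : ℝ) (hR : ∀ b ∈ V, 0 ≤ R b)
    (hOK : O ⊆ K) (hKL : K ⊆ L) (hLP : L ⊆ P) (hKP' : K' ⊆ P') (hLP' : L' ⊆ P')
    (hO'V : (O' ∩ (P \ O)) ∩ V = ∅)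
    (hHarPO' : (∑ b ∈ P, w b) * (∑ b ∈ O' ∩ V, w b) ≤ ∑ b ∈ (P ∩ O') ∩ V, w b)
    (hpair₁ : (∑ b ∈ L, w b) * (∑ b ∈ (K' ∩ L') ∩ V, w b) + (∑ b ∈ K' ∩ L', w b) * (∑ b ∈ L ∩ V, w b)
        - (∑ b ∈ V, w b) * (∑ b ∈ L, w b) * (∑ b ∈ K' ∩ L', w b) ≤ ∑ b ∈ (L ∩ (K' ∩ L')) ∩ V, R b)
    (hpair₂ : (∑ b ∈ K, w b) * (∑ b ∈ (K' ∪ L') ∩ V, w b) + (∑ b ∈ K' ∪ L', w b) * (∑ b ∈ K ∩ V, w b)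
        - (∑ b ∈ V, w b) * (∑ b ∈ K, w b) * (∑ b ∈ K' ∪ L', w b) ≤ ∑ b ∈ (K ∩ (K' ∪ L')) ∩ V, R b)
    (hHarV' : (∑ b ∈ P', w b) * (∑ b ∈ P ∩ V, w b) ≤ ∑ b ∈ (P ∩ P') ∩ V, w b)
    (hY : ((∑ b ∈ L, w b) - ∑ b ∈ K, w b) * ((∑ b ∈ K', w b) - ∑ b ∈ K' ∩ L', w b) ≤ Y) :
    0 ≤ (∑ b ∈ (P ∩ P') ∩ V, w b) + (∑ b ∈ (O ∩ O') ∩ V, w b)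
        - (∑ b ∈ P, w b) * (∑ b ∈ O' ∩ V, w b) - (∑ b ∈ P', w b) * (∑ b ∈ O ∩ V, w b)
        + (∑ b ∈ (K ∩ K') ∩ V, R b) + (∑ b ∈ (L ∩ L') ∩ V, R b)
        - ((∑ b ∈ K, w b) * (∑ b ∈ L' ∩ V, w b) + (∑ b ∈ L', w b) * (∑ b ∈ K ∩ V, w b)
            - (∑ b ∈ V, w b) * (∑ b ∈ K, w b) * (∑ b ∈ L', w b))
        - ((∑ b ∈ L, w b) * (∑ b ∈ K' ∩ V, w b) + (∑ b ∈ K', w b) * (∑ b ∈ L ∩ V, w b)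
            - (∑ b ∈ V, w b) * (∑ b ∈ L, w b) * (∑ b ∈ K', w b))
        + (1 - ∑ b ∈ V, w b) * Y := by
  have hsup := nestedKL_footprints_le_supply R V K L K' L' hR hKL
  have hPO' := inter_corner_trace_eq V P O O' (hOK.trans (hKL.trans hLP)) hO'V
  rw [hPO'] at hHarPO'
  have hJ : ∑ b ∈ K' ∪ L', w b = ∑ b ∈ K', w b + ∑ b ∈ L', w b - ∑ b ∈ K' ∩ L', w b := by
    have := sum_union_trace w (Finset.univ : Finset B) K' L'
    simpa only [Finset.inter_univ] using this
  have hJV := sum_union_trace w V K' L'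
  rw [hJ, hJV] at hpair₂
  have h4 : ∑ b ∈ K', w b + ∑ b ∈ L', w b ≤ ∑ b ∈ P', w b + ∑ b ∈ K' ∩ L', w b := by
    have := union_inter_le w (Finset.univ : Finset B) K' L' P' (fun b _ => hw b) hKP' hLP'
    simpa only [Finset.inter_univ] using this
  have hcE : ∑ b ∈ K' ∩ V, w b - ∑ b ∈ (K' ∩ L') ∩ V, w b ≤ ∑ b ∈ K', w b - ∑ b ∈ K' ∩ L', w b :=
    trace_diff_le w V K' (K' ∩ L') hw Finset.inter_subset_left
  have haPO : ∑ b ∈ L ∩ V, w b - ∑ b ∈ K ∩ V, w b ≤ ∑ b ∈ P ∩ V, w b - ∑ b ∈ O ∩ V, w b := by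
    have h1 : ∑ b ∈ L ∩ V, w b ≤ ∑ b ∈ P ∩ V, w b := sum_le_sum_of_subset' w hw (Finset.inter_subset_inter hLP le_rfl)
    have h2 : ∑ b ∈ O ∩ V, w b ≤ ∑ b ∈ K ∩ V, w b := sum_le_sum_of_subset' w hw (Finset.inter_subset_inter hOK le_rfl)
    linarith
  have haKL : ∑ b ∈ K ∩ V, w b ≤ ∑ b ∈ L ∩ V, w b := sum_le_sum_of_subset' w hw (Finset.inter_subset_inter hKL le_rfl)
  have hv1 : ∑ b ∈ V, w b ≤ 1 := by
    rw [← hw1]; exact sum_le_sum_of_subset' w hw (Finset.subset_univ V)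
  have hk0 : 0 ≤ ∑ b ∈ K, w b := Finset.sum_nonneg fun b _ => hw b
  have hkl : ∑ b ∈ K, w b ≤ ∑ b ∈ L, w b := sum_le_sum_of_subset' w hw hKL
  have hp'0 : 0 ≤ ∑ b ∈ P', w b := Finset.sum_nonneg fun b _ => hw b
  have hk'nn : 0 ≤ ∑ b ∈ K', w b := Finset.sum_nonneg fun b _ => hw b
  have hl'nn : 0 ≤ ∑ b ∈ L', w b := Finset.sum_nonneg fun b _ => hw b
  have hMK'w : ∑ b ∈ K' ∩ L', w b ≤ ∑ b ∈ K', w b := sum_le_sum_of_subset' w hw Finset.inter_subset_left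
  have hm'0 : 0 ≤ ∑ b ∈ K' ∩ L', w b := Finset.sum_nonneg fun b _ => hw b
  set p := ∑ b ∈ P, w b
  set k := ∑ b ∈ K, w b
  set l := ∑ b ∈ L, w b
  set v := ∑ b ∈ V, w b
  set aP := ∑ b ∈ P ∩ V, w b
  set aK := ∑ b ∈ K ∩ V, w b
  set aL := ∑ b ∈ L ∩ V, w b
  set aO := ∑ b ∈ O ∩ V, w b
  set p' := ∑ b ∈ P', w b
  set k' := ∑ b ∈ K', w b
  set l' := ∑ b ∈ L', w b
  set m' := ∑ b ∈ K' ∩ L', w b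
  set aK' := ∑ b ∈ K' ∩ V, w b
  set aM' := ∑ b ∈ (K' ∩ L') ∩ V, w b
  have F2 : (k' - m') * (aL - aK) ≤ p' * (aP - aO) := by
    have h1 : aL - aK ≤ aP - aO := haPO
    have h2 : 0 ≤ aL - aK := by linarith
    have h3 : k' - m' ≤ p' := by linarith
    calc (k' - m') * (aL - aK) ≤ (k' - m') * (aP - aO) := mul_le_mul_of_nonneg_left h1 (by linarith)
      _ ≤ p' * (aP - aO) := mul_le_mul_of_nonneg_right h3 (by linarith)
  have F3 : 0 ≤ (l - k) * ((k' - m') - (aK' - aM')) := mul_nonneg (by linarith) (by linarith)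
  have F4 : 0 ≤ (1 - v) * (Y - (l - k) * (k' - m')) := mul_nonneg (by linarith) (by linarith)
  have hp0 : 0 ≤ ∑ b ∈ P, w b := Finset.sum_nonneg fun b _ => hw b
  nlinarith [hsup, hpair₁, hpair₂, hHarV', F2, F3, F4, hHarPO']

end Summit.CriticalPhenomena.PercolationContinuityZ3.Theorems.SahiE3ExchangeNestedCorner
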